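import Mathlib
import HarnessLib

/-!
# Screw ⊃ lattice: a Killing field with `a ∉ range A` has a pitch vector — crux stmt-NavierStokesRegularity-4053 (`Theses.SymmetryModuliCount.SymmetricLiouville`), line blowdown-kills-pitch, stub `stub_screwIsPeriodic`

Pure kinematics on `ℝ³ = EuclideanSpace ℝ (Fin 3)`, Mathlib only (no Navier–Stokes content).

**Statement** (`stub_screwIsPeriodic`). Let `A : ℝ³ →L[ℝ] ℝ³` be skew (`⟪A x, x⟫ = 0` for all `x`) and
`a ∉ range A` (a translation `A = 0, a ≠ 0`, or a screw motion of nonzero pitch). Then there is a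
PITCH VECTOR `e ≠ 0`, depending only on `(a, A)`, such that every differentiable `v : ℝ³ → ℝ³` with
`Dv(x)[a + A x] = A v(x)` for all `x` (the field is annihilated by the Killing field `X(x) = a + A x`)
is `e`-periodic: `v (x + e) = v x`.

**Proof.**
* Linear algebra (`skew_apply_eq`, `skew_cube_eq_neg_smul`): in coordinates a skew map of `ℝ³` is a
  cross product `x ↦ ω × x`, hence `A³ = -ρ² A` with `ρ² = ‖ω‖²`; we arrange `ρ > 0` (for `A = 0` take
  `ρ = 1`). Rescaling the flow parameter, `B := ρ⁻¹ A` satisfies `B³ = -B`, and the clause for `(a, A)`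
  is the clause for `(ρ⁻¹ a, B)`.
* Calculus (`hasDerivAt_rodrigues`, `hasDerivAt_screwOrbit`, `periodic_of_unit_screw_clause`): for
  `B³ = -B` the Rodrigues formula `M_θ w = w + sin θ • B w + (1 - cos θ) • B² w` solves `M' = B M`,
  `M_0 = id`, `M_{2π} = id`, and the explicit screw orbit
  `γ θ = M_θ x + (θ • a + (1 - cos θ) • B a + (θ - sin θ) • B² a)` solves `γ' = a + B γ`, `γ 0 = x`,
  `γ (2π) = x + 2π • (a + B² a)`. Along it `W θ := v (γ θ) - M_θ (v x)` solves `W' = B W`, `W 0 = 0`,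
  and `‖W‖²` is constant because `B` is skew; so `v (x + 2π • (a + B² a)) = M_{2π} (v x) = v x`.
* The pitch vector `e = 2π • (ρ⁻¹ a + B² (ρ⁻¹ a))` is nonzero: otherwise `a = A (-B (ρ⁻¹ a)) ∈ range A`.

This generalises the kernel-checked normal form (`A = J`, `a = h e_z`) of
`Theorems/SymmetricLiouville/Negative/ScrewClause.lean` (`screw_equivariant`,
`periodic_of_screw_clause`), whose `‖W‖²`-conservation argument is imitated here.
-/

noncomputable section

open scoped RealInnerProductSpace

namespace Summit.NavierStokesRegularity.NavierStokesRegularity.Theorems.SymmetryModuliCountSymmetricLiouville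

/-- Local notation for physical space `ℝ³`. -/
local notation "E3" => EuclideanSpace ℝ (Fin 3)

/-! ## Linear algebra of skew maps of `ℝ³` -/

/-- Polarisation of skewness: `⟪A x, x⟫ = 0` for all `x` gives `⟪A x, y⟫ = -⟪A y, x⟫`. -/
theorem inner_skew_swap (A : E3 →L[ℝ] E3) (hA : ∀ x, ⟪A x, x⟫ = 0) (x y : E3) :
    ⟪A x, y⟫ = -⟪A y, x⟫ := by
  have h := hA (x + y)
  rw [map_add, inner_add_left, inner_add_right, inner_add_right, hA x, hA y, zero_add,
    add_zero] at h
  linarith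

/-- **A skew map of `ℝ³` is a cross product**: in coordinates
`A x = (-α x₁ - β x₂, α x₀ - γ x₂, β x₀ + γ x₁)` (i.e. `A x = ω × x` with `ω = (γ, -β, α)`), where
`α = (A e₀)₁`, `β = (A e₀)₂`, `γ = (A e₁)₂` are the three free entries of the antisymmetric matrix. -/
theorem skew_apply_eq (A : E3 →L[ℝ] E3) (hA : ∀ x, ⟪A x, x⟫ = 0) :
    ∃ α β γ : ℝ, ∀ x : E3,
      A x = WithLp.toLp 2 ![-α * x 1 - β * x 2, α * x 0 - γ * x 2, β * x 0 + γ * x 1] := by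
  have hpol := inner_skew_swap A hA
  -- the matrix of `A` is antisymmetric
  have hent : ∀ i j : Fin 3,
      A (EuclideanSpace.single j 1) i = -A (EuclideanSpace.single i 1) j := by
    intro i j
    have h := hpol (EuclideanSpace.single j 1) (EuclideanSpace.single i 1)
    simpa [EuclideanSpace.inner_single_right] using h
  have hdiag : ∀ i : Fin 3, A (EuclideanSpace.single i 1) i = 0 := by
    intro i
    have h := hA (EuclideanSpace.single i 1)
    simpa [EuclideanSpace.inner_single_right] using h
  -- expansion along the standard basis
  have hexp : ∀ x : E3, A x = x 0 • A (EuclideanSpace.single 0 1) +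
      x 1 • A (EuclideanSpace.single 1 1) + x 2 • A (EuclideanSpace.single 2 1) := by
    intro x
    have hx : x = x 0 • EuclideanSpace.single 0 (1 : ℝ) + x 1 • EuclideanSpace.single 1 (1 : ℝ) +
        x 2 • EuclideanSpace.single 2 (1 : ℝ) := by
      ext i; fin_cases i <;> simp
    calc A x = A (x 0 • EuclideanSpace.single 0 (1 : ℝ) + x 1 • EuclideanSpace.single 1 (1 : ℝ) +
          x 2 • EuclideanSpace.single 2 (1 : ℝ)) := by rw [← hx]
      _ = _ := by simp only [map_add, map_smul]
  have hc0 : ∀ x : E3, A x 0 = -(A (EuclideanSpace.single 0 1) 1) * x 1 -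
      A (EuclideanSpace.single 0 1) 2 * x 2 := by
    intro x
    rw [hexp x]
    simp only [PiLp.add_apply, PiLp.smul_apply, smul_eq_mul]
    rw [hdiag 0, hent 0 1, hent 0 2]
    ring
  have hc1 : ∀ x : E3, A x 1 = A (EuclideanSpace.single 0 1) 1 * x 0 -
      A (EuclideanSpace.single 1 1) 2 * x 2 := by
    intro x
    rw [hexp x]
    simp only [PiLp.add_apply, PiLp.smul_apply, smul_eq_mul]
    rw [hdiag 1, hent 1 2]
    ring
  have hc2 : ∀ x : E3, A x 2 = A (EuclideanSpace.single 0 1) 2 * x 0 +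
      A (EuclideanSpace.single 1 1) 2 * x 1 := by
    intro x
    rw [hexp x]
    simp only [PiLp.add_apply, PiLp.smul_apply, smul_eq_mul]
    rw [hdiag 2]
    ring
  refine ⟨A (EuclideanSpace.single 0 1) 1, A (EuclideanSpace.single 0 1) 2,
    A (EuclideanSpace.single 1 1) 2, fun x => ?_⟩
  ext i
  fin_cases i
  · simpa using hc0 x
  · simpa using hc1 x
  · simpa using hc2 x

/-- **Skew maps of `ℝ³` satisfy `A³ = -ρ² A` with `ρ > 0`**: for `A x = ω × x` one has
`ω × (ω × (ω × x)) = -‖ω‖² (ω × x)`, so `ρ = ‖ω‖` when `A ≠ 0`; for `A = 0` we take `ρ = 1`. -/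
theorem skew_cube_eq_neg_smul (A : E3 →L[ℝ] E3) (hA : ∀ x, ⟪A x, x⟫ = 0) :
    ∃ ρ : ℝ, 0 < ρ ∧ ∀ x, A (A (A x)) = -(ρ ^ 2) • A x := by
  obtain ⟨α, β, γ, hAx⟩ := skew_apply_eq A hA
  have hcube : ∀ x, A (A (A x)) = -(α ^ 2 + β ^ 2 + γ ^ 2) • A x := by
    intro x
    ext i
    fin_cases i <;> simp [hAx] <;> ring
  by_cases hz : α ^ 2 + β ^ 2 + γ ^ 2 = 0
  · have hα : α = 0 := by nlinarith [sq_nonneg α, sq_nonneg β, sq_nonneg γ]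
    have hβ : β = 0 := by nlinarith [sq_nonneg α, sq_nonneg β, sq_nonneg γ]
    have hγ : γ = 0 := by nlinarith [sq_nonneg α, sq_nonneg β, sq_nonneg γ]
    have hA0 : ∀ x, A x = 0 := by
      intro x
      rw [hAx x]
      ext i
      fin_cases i <;> simp [hα, hβ, hγ]
    exact ⟨1, one_pos, fun x => by simp [hA0]⟩
  · have hpos : 0 < α ^ 2 + β ^ 2 + γ ^ 2 := lt_of_le_of_ne (by positivity) (Ne.symm hz)
    refine ⟨Real.sqrt (α ^ 2 + β ^ 2 + γ ^ 2), Real.sqrt_pos.2 hpos, fun x => ?_⟩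
    rw [Real.sq_sqrt hpos.le]
    exact hcube x

/-! ## The unit-rate screw flow (`B³ = -B`) -/

/-- **Rodrigues' formula solves `M' = B M`.** For `B³ = -B`, the curve
`θ ↦ M_θ w = w + sin θ • B w + (1 - cos θ) • B (B w)` has velocity `B (M_θ w)`. -/
theorem hasDerivAt_rodrigues (B : E3 →L[ℝ] E3) (hB3 : ∀ x, B (B (B x)) = -B x) (w : E3) (θ : ℝ) :
    HasDerivAt (fun φ : ℝ => w + Real.sin φ • B w + (1 - Real.cos φ) • B (B w))
      (B (w + Real.sin θ • B w + (1 - Real.cos θ) • B (B w))) θ := by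
  have h1 : HasDerivAt (fun φ : ℝ => Real.sin φ • B w) (Real.cos θ • B w) θ :=
    (Real.hasDerivAt_sin θ).smul_const _
  have h2 : HasDerivAt (fun φ : ℝ => (1 - Real.cos φ) • B (B w)) (Real.sin θ • B (B w)) θ := by
    simpa using ((Real.hasDerivAt_cos θ).const_sub 1).smul_const (B (B w))
  refine ((h1.const_add w).add h2).congr_deriv ?_
  simp only [map_add, map_smul, hB3]
  module

/-- **The explicit screw orbit solves `γ' = a + B γ`.** For `B³ = -B`, the curve
`γ θ = M_θ x + (θ • a + (1 - cos θ) • B a + (θ - sin θ) • B (B a))` (Rodrigues part plus the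
integrated translation `∫₀^θ M_s a ds`) has velocity `a + B (γ θ)`. -/
theorem hasDerivAt_screwOrbit (a : E3) (B : E3 →L[ℝ] E3) (hB3 : ∀ x, B (B (B x)) = -B x)
    (x : E3) (θ : ℝ) :
    HasDerivAt (fun φ : ℝ => (x + Real.sin φ • B x + (1 - Real.cos φ) • B (B x)) +
        (φ • a + (1 - Real.cos φ) • B a + (φ - Real.sin φ) • B (B a)))
      (a + B ((x + Real.sin θ • B x + (1 - Real.cos θ) • B (B x)) +
        (θ • a + (1 - Real.cos θ) • B a + (θ - Real.sin θ) • B (B a)))) θ := by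
  have h1 : HasDerivAt (fun φ : ℝ => φ • a) a θ := by
    simpa using (hasDerivAt_id θ).smul_const a
  have h2 : HasDerivAt (fun φ : ℝ => (1 - Real.cos φ) • B a) (Real.sin θ • B a) θ := by
    simpa using ((Real.hasDerivAt_cos θ).const_sub 1).smul_const (B a)
  have h3 : HasDerivAt (fun φ : ℝ => (φ - Real.sin φ) • B (B a)) ((1 - Real.cos θ) • B (B a)) θ :=
    ((hasDerivAt_id θ).sub (Real.hasDerivAt_sin θ)).smul_const _
  refine ((hasDerivAt_rodrigues B hB3 x θ).add ((h1.add h2).add h3)).congr_deriv ?_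
  simp only [map_add, map_smul, hB3]
  module

/-- **Integrating the unit-rate screw clause over one period.** If `B` is skew with `B³ = -B` and a
differentiable `v` satisfies `Dv(x)[a + B x] = B v(x)` for all `x`, then
`v (x + 2π • (a + B (B a))) = v x`: along the screw orbit `γ` through `x`,
`W θ = v (γ θ) - M_θ (v x)` solves `W' = B W`, `W 0 = 0`, and `‖W‖²` is constant (`B` skew), so
`W (2π) = 0`, where `γ (2π) = x + 2π • (a + B (B a))` and `M_{2π} = id`. -/
theorem periodic_of_unit_screw_clause (a : E3) (B : E3 →L[ℝ] E3) (hB : ∀ x, ⟪B x, x⟫ = 0)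
    (hB3 : ∀ x, B (B (B x)) = -B x) {v : E3 → E3} (hv : Differentiable ℝ v)
    (hcl : ∀ x, fderiv ℝ v x (a + B x) = B (v x)) (x : E3) :
    v (x + (2 * Real.pi) • (a + B (B a))) = v x := by
  -- the orbit, the Rodrigues rotation of `v x`, and their difference `W`
  set γ : ℝ → E3 := fun φ => (x + Real.sin φ • B x + (1 - Real.cos φ) • B (B x)) +
    (φ • a + (1 - Real.cos φ) • B a + (φ - Real.sin φ) • B (B a)) with hγ
  set M : ℝ → E3 := fun φ => v x + Real.sin φ • B (v x) + (1 - Real.cos φ) • B (B (v x)) with hM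
  set W : ℝ → E3 := fun φ => v (γ φ) - M φ with hW
  -- `W' = B W`
  have hWd : ∀ φ, HasDerivAt W (B (W φ)) φ := by
    intro φ
    have h1 : HasDerivAt (fun ψ => v (γ ψ)) (fderiv ℝ v (γ φ) (a + B (γ φ))) φ :=
      (hv (γ φ)).hasFDerivAt.comp_hasDerivAt φ (hasDerivAt_screwOrbit a B hB3 x φ)
    rw [hcl (γ φ)] at h1
    have h2 : HasDerivAt M (B (M φ)) φ := hasDerivAt_rodrigues B hB3 (v x) φ
    have h3 := h1.sub h2
    rwa [← map_sub] at h3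
  -- `‖W‖²` is constant (`B` is skew) and `W 0 = 0`
  have hn : ∀ φ, HasDerivAt (fun ψ => ⟪W ψ, W ψ⟫) 0 φ := by
    intro φ
    have h1 := (hWd φ).inner ℝ (hWd φ)
    have e : ⟪W φ, B (W φ)⟫ + ⟪B (W φ), W φ⟫ = 0 := by
      rw [real_inner_comm, hB, add_zero]
    rwa [e] at h1
  have hconst : ∀ φ, ⟪W φ, W φ⟫ = ⟪W 0, W 0⟫ := fun φ =>
    is_const_of_deriv_eq_zero (fun ψ => (hn ψ).differentiableAt) (fun ψ => (hn ψ).deriv) φ 0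
  have hW0 : W 0 = 0 := by simp [hW, hγ, hM]
  have hW2 : W (2 * Real.pi) = 0 := by
    have h1 := hconst (2 * Real.pi)
    rw [hW0, inner_zero_left, real_inner_self_eq_norm_sq] at h1
    have : ‖W (2 * Real.pi)‖ = 0 := by nlinarith [norm_nonneg (W (2 * Real.pi))]
    exact norm_eq_zero.1 this
  -- evaluate at `θ = 2π`
  have h : v (γ (2 * Real.pi)) - M (2 * Real.pi) = 0 := hW2
  have hγ2 : γ (2 * Real.pi) = x + (2 * Real.pi) • (a + B (B a)) := by
    simp [hγ, smul_add]
  have hM2 : M (2 * Real.pi) = v x := by simp [hM]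
  rwa [sub_eq_zero, hγ2, hM2] at h

/-! ## The stub -/

/-- **Stub `stub_screwIsPeriodic` — screw ⊃ lattice (kinematic bridge).** For a skew `A` on `ℝ³` and
`a ∉ range A` there is a nonzero pitch vector `e` such that every differentiable `v : ℝ³ → ℝ³` with
`Dv(x)[a + A x] = A v(x)` for all `x` satisfies `v (x + e) = v x` for all `x`. With `A³ = -ρ² A`,
`ρ > 0` (`skew_cube_eq_neg_smul`) and `B = ρ⁻¹ A`: `e = 2π • (ρ⁻¹ a + B (B (ρ⁻¹ a)))`
(`= (2π/ρ) P_{ker A} a` for `A ≠ 0`, `= 2π a` for `A = 0`). -/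
theorem stub_screwIsPeriodic :
    ∀ (a : E3) (A : E3 →L[ℝ] E3), (∀ x, inner ℝ (A x) x = 0) → a ∉ Set.range A →
      ∃ e : E3, e ≠ 0 ∧ ∀ v : E3 → E3, Differentiable ℝ v →
        (∀ x, fderiv ℝ v x (a + A x) = A (v x)) → ∀ x, v (x + e) = v x := by
  intro a A hA hra
  obtain ⟨ρ, hρ, hA3⟩ := skew_cube_eq_neg_smul A hA
  have hρ0 : ρ ≠ 0 := hρ.ne'
  -- the unit-rate generator `B = ρ⁻¹ A`: skew, `B³ = -B`, `A = ρ B`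
  set B : E3 →L[ℝ] E3 := ρ⁻¹ • A
  have hBx : ∀ x, B x = ρ⁻¹ • A x := fun x => rfl
  have hAB : ∀ x, A x = ρ • B x := fun x => by
    rw [hBx, smul_smul, mul_inv_cancel₀ hρ0, one_smul]
  have hBskew : ∀ x, ⟪B x, x⟫ = 0 := fun x => by
    rw [hBx, real_inner_smul_left, hA, mul_zero]
  have hB3 : ∀ x, B (B (B x)) = -B x := fun x => by
    simp only [hBx, map_smul, hA3, smul_smul]
    rw [← neg_smul]
    congr 1
    field_simp
  refine ⟨(2 * Real.pi) • (ρ⁻¹ • a + B (B (ρ⁻¹ • a))), ?_, ?_⟩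
  · -- the pitch vector is nonzero because `a ∉ range A`
    intro h0
    rcases smul_eq_zero.1 h0 with h | h
    · exact Real.two_pi_pos.ne' h
    · refine hra ⟨-(B (ρ⁻¹ • a)), ?_⟩
      have h' : B (B (ρ⁻¹ • a)) = -(ρ⁻¹ • a) := eq_neg_of_add_eq_zero_right h
      rw [map_neg, hAB (B (ρ⁻¹ • a)), h', smul_neg, neg_neg, smul_smul, mul_inv_cancel₀ hρ0,
        one_smul]
  · -- the clause for `(a, A)` is the clause for `(ρ⁻¹ a, B)`; integrate it over one period
    intro v hv hcl x
    have hcl' : ∀ y, fderiv ℝ v y (ρ⁻¹ • a + B y) = B (v y) := fun y => by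
      rw [hBx y, hBx (v y), ← smul_add, map_smul, hcl y]
    exact periodic_of_unit_screw_clause (ρ⁻¹ • a) B hBskew hB3 hv hcl' x

end Summit.NavierStokesRegularity.NavierStokesRegularity.Theorems.SymmetryModuliCountSymmetricLiouville

end
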